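import Mathlib.RingTheory.Coprime.Lemmas
import Mathlib.Data.Nat.Factorization.Basic
import Literature.NumberTheory.Automorphic.JordanZassenhaus
import HarnessLib

/-!
# Localisation of `ℤ`-lattices at a prime and the local–global principle

For a `ℤ`-submodule `L` of an abelian group / `ℚ`-vector space `V` and a prime `p` we realise the
localisation `L_(p) = ℤ_(p) ⊗ L` *inside* `V` as the `ℤ`-submodule
`localAt p L = {x | m x ∈ L for some m ≥ 1 prime to p}` (Voight, *Quaternion Algebras*, 9.4;
Reiner, *Maximal Orders*, §§3–4), and prove the standard dictionary used throughout the
arithmetic of orders and ideals in quaternion algebras (Voight Ch. 9, 16, 17, 26):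

* lattice algebra: `localAt` is a closure operator commuting with `⊓`, `⊔`, products of
  submodules of a ring (`localAt_mul`) and translates by units (`localAt_units_smul`,
  `localAt_op_units_smul`); `L_(p)` is a `ℤ_(p)`-module (`inv_smul_mem_localAt`); Bézout tricks
  `exists_sub_mem_of_mem_localAt` (`L_(p) = L + p^k L_(p)`) and `exists_eq_pow_smul_of_mem`
  (`L ∩ p^k L_(p) = p^k L`), which give `L / p^k L ≃ L_(p) / p^k L_(p)`;
* **local–global principle** (Voight Lemma 9.4.6, Cor. 9.4.7): `L = ⋂ₚ L_(p)`
  (`iInf_localAt_eq`, `mem_of_forall_prime_mem_localAt`), inclusion and equality of submodules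
  are local properties (`le_iff_forall_prime_localAt_le`, `eq_iff_forall_prime_localAt_eq`);
* **indices localise**: for a finite-index sublattice `L' ≤ L`, `[L_(p) : L'_(p)] = p^{v_p [L:L']}`
  (`relIndex_localAt`; via `L_(p) = L + L'_(p)`, the `p`-saturation `L ∩ L'_(p)` and Cauchy's
  theorem), so that `[L : L'] = ∏ₚ [L_(p) : L'_(p)]`;
* **gluing** (Voight Thm. 9.4.9, one prime at a time): a `ℤ_(p)`-module `N` commensurable with
  `L_(p)` is the localisation at `p` of a unique submodule agreeing with `L` at all other primes
  (`exists_localAt_eq_and_forall_localAt_eq`).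

Everything is elementary (Bézout and Cauchy); no localisation of rings is used, so the results
apply verbatim to `ℤ`-orders `O ⊆ B` in a `ℚ`-algebra and their one-sided ideals. Indices are
Mathlib's `AddSubgroup.relIndex` on `toAddSubgroup`, as in `BrandtModule.lean`.

## What is not here

Local *structure* of orders (maximal orders, Eichler orders, completions) and the theorem that
invertible ideals are locally principal (Kaplansky) — these live in the files on quaternion
orders that import this one.
-/

noncomputable section

open scoped Pointwise

universe u

namespace Literature.NumberTheory.Automorphic

/-! ### Localisation of a `ℤ`-submodule of a `ℚ`-vector space at a prime -/

section IntModule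

variable {V : Type u} [AddCommGroup V]

/-- The **localisation at `p`** of a `ℤ`-submodule `L` of a `ℚ`-vector space `V`, realised inside
`V`: `L_(p) = ℤ_(p) · L = {x ∈ V | m x ∈ L for some integer m ≥ 1 prime to p}` (Reiner, *Maximal
Orders*, §3; Voight, *Quaternion Algebras*, 9.4). It is a `ℤ`-submodule of `V` (indeed a
`ℤ_(p)`-module, `inv_smul_mem_localAt`) containing `L`. Intended for `p` prime; junk values
`localAt 0 L = L` and `localAt 1 L = {x | ∃ m ≥ 1, m x ∈ L}`. [folklore] -/
def localAt (p : ℕ) (L : Submodule ℤ V) : Submodule ℤ V where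
  carrier := {x | ∃ m : ℕ, m ≠ 0 ∧ m.Coprime p ∧ (m : ℤ) • x ∈ L}
  add_mem' := by
    rintro a b ⟨m, hm0, hm, hma⟩ ⟨n, hn0, hn, hnb⟩
    refine ⟨m * n, mul_ne_zero hm0 hn0, hm.mul_left hn, ?_⟩
    rw [smul_add, Nat.cast_mul, mul_comm, mul_smul, mul_comm, mul_smul]
    exact L.add_mem (L.smul_mem _ hma) (L.smul_mem _ hnb)
  zero_mem' := ⟨1, one_ne_zero, Nat.coprime_one_left p, by rw [smul_zero]; exact L.zero_mem⟩
  smul_mem' := by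
    rintro c x ⟨m, hm0, hm, hmx⟩
    exact ⟨m, hm0, hm, by rw [smul_comm]; exact L.smul_mem c hmx⟩

/-- `x ∈ L_(p) ↔ m x ∈ L` for some `m ≥ 1` prime to `p` (definitional). [folklore] -/
theorem mem_localAt_iff {p : ℕ} {L : Submodule ℤ V} {x : V} :
    x ∈ localAt p L ↔ ∃ m : ℕ, m ≠ 0 ∧ m.Coprime p ∧ (m : ℤ) • x ∈ L := Iff.rfl

/-- `L ⊆ L_(p)`. [folklore] -/
theorem le_localAt (p : ℕ) (L : Submodule ℤ V) : L ≤ localAt p L :=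
  fun x hx => ⟨1, one_ne_zero, Nat.coprime_one_left p, by rwa [Nat.cast_one, one_smul]⟩

/-- If `m x ∈ L` with `m ≥ 1` prime to `p` then `x ∈ L_(p)`. [folklore] -/
theorem mem_localAt_of_smul_mem {p : ℕ} {L : Submodule ℤ V} {x : V} {m : ℕ} (hm0 : m ≠ 0)
    (hm : m.Coprime p) (hx : (m : ℤ) • x ∈ L) : x ∈ localAt p L := ⟨m, hm0, hm, hx⟩

/-- Localisation is monotone. [folklore] -/
theorem localAt_mono (p : ℕ) {L L' : Submodule ℤ V} (h : L ≤ L') : localAt p L ≤ localAt p L' :=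
  fun _ ⟨m, hm0, hm, hmx⟩ => ⟨m, hm0, hm, h hmx⟩

/-- Localisation is idempotent: `(L_(p))_(p) = L_(p)`. [folklore] -/
@[simp] theorem localAt_localAt (p : ℕ) (L : Submodule ℤ V) :
    localAt p (localAt p L) = localAt p L := by
  refine le_antisymm ?_ (le_localAt p _)
  rintro x ⟨m, hm0, hm, n, hn0, hn, hnmx⟩
  refine ⟨n * m, mul_ne_zero hn0 hm0, hn.mul_left hm, ?_⟩
  rwa [Nat.cast_mul, mul_smul]

/-- `L_(p) ≤ L'_(p) ↔ L ≤ L'_(p)`. [folklore] -/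
theorem localAt_le_localAt_iff {p : ℕ} {L L' : Submodule ℤ V} :
    localAt p L ≤ localAt p L' ↔ L ≤ localAt p L' :=
  ⟨fun h => (le_localAt p L).trans h, fun h => by simpa using localAt_mono p h⟩

/-- Localisation commutes with finite intersections. [folklore] -/
theorem localAt_inf (p : ℕ) (L L' : Submodule ℤ V) :
    localAt p (L ⊓ L') = localAt p L ⊓ localAt p L' := by
  refine le_antisymm (le_inf (localAt_mono p inf_le_left) (localAt_mono p inf_le_right)) ?_
  rintro x ⟨⟨m, hm0, hm, hmx⟩, ⟨n, hn0, hn, hnx⟩⟩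
  refine ⟨m * n, mul_ne_zero hm0 hn0, hm.mul_left hn, ?_, ?_⟩
  · rw [Nat.cast_mul, mul_comm, mul_smul]
    exact L.smul_mem _ hmx
  · rw [Nat.cast_mul, mul_smul]
    exact L'.smul_mem _ hnx

/-- The localisation of a span is the set of `ℤ_(p)`-combinations: `x ∈ (span s)_(p)` iff
`m x ∈ span s` for some `m` prime to `p` (restatement for rewriting). [folklore] -/
theorem localAt_eq_of_le_of_le {p : ℕ} {L L' : Submodule ℤ V} (h₁ : L ≤ localAt p L')
    (h₂ : L' ≤ localAt p L) : localAt p L = localAt p L' :=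
  le_antisymm (localAt_le_localAt_iff.mpr h₁) (localAt_le_localAt_iff.mpr h₂)

/-- A sublattice of index prime to `p` has the same localisation at `p`: if `L' ≤ L` and
`m L ⊆ L'` with `m` prime to `p`, then `L_(p) = L'_(p)`. [folklore] -/
theorem localAt_eq_of_smul_le {p : ℕ} {L L' : Submodule ℤ V} (hle : L' ≤ L) {m : ℕ} (hm0 : m ≠ 0)
    (hm : m.Coprime p) (hmL : ∀ x ∈ L, (m : ℤ) • x ∈ L') : localAt p L = localAt p L' :=
  localAt_eq_of_le_of_le (fun x hx => ⟨m, hm0, hm, hmL x hx⟩) (hle.trans (le_localAt p L))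

/-! #### Bézout: inverting integers prime to `p` modulo `p ^ k` -/

/-- For `m` prime to `p` and any `k` there is an integer `u` with `u m ≡ 1 (mod p ^ k)`, in the
form `u * m + v * p ^ k = 1`. [folklore] -/
theorem exists_mul_add_mul_pow_eq_one {m p : ℕ} (hm : m.Coprime p) (k : ℕ) :
    ∃ u v : ℤ, u * m + v * (p : ℤ) ^ k = 1 := by
  have h : IsCoprime (m : ℤ) ((p : ℤ) ^ k) := by
    have := Nat.isCoprime_iff_coprime.mpr (hm.pow_right k)
    simpa using this
  obtain ⟨u, v, huv⟩ := h
  exact ⟨u, v, huv⟩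

/-- **Approximation**: if `x ∈ L_(p)` then `x ≡ y (mod p^k L_(p))` for some `y ∈ L`; precisely
`x - y = p ^ k • z` with `z ∈ L_(p)` (indeed `z ∈ ℤ x`). [folklore] -/
theorem exists_sub_mem_of_mem_localAt {p : ℕ} {L : Submodule ℤ V} {x : V} (hx : x ∈ localAt p L)
    (k : ℕ) : ∃ y ∈ L, ∃ z ∈ localAt p L, x - y = ((p : ℤ) ^ k) • z := by
  obtain ⟨m, hm0, hm, hmx⟩ := hx
  obtain ⟨u, v, huv⟩ := exists_mul_add_mul_pow_eq_one hm k
  refine ⟨(u * m) • x, ?_, v • x, (localAt p L).smul_mem v ⟨m, hm0, hm, hmx⟩, ?_⟩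
  · rw [mul_smul]
    exact L.smul_mem u hmx
  · have hv : v * (p : ℤ) ^ k = 1 - u * m := by linear_combination huv
    rw [smul_comm, ← mul_smul, hv, sub_smul, one_smul]

/-- `L ∩ p^k L_(p) = p^k L`: an element of `L` divisible by `p ^ k` in `L_(p)` is divisible by
`p ^ k` in `L`. [folklore] -/
theorem exists_eq_pow_smul_of_mem {p : ℕ} {L : Submodule ℤ V} {x z : V} (hx : x ∈ L)
    (hz : z ∈ localAt p L) (k : ℕ) (h : x = ((p : ℤ) ^ k) • z) : ∃ w ∈ L, x = ((p : ℤ) ^ k) • w := by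
  obtain ⟨m, hm0, hm, hmz⟩ := hz
  obtain ⟨u, v, huv⟩ := exists_mul_add_mul_pow_eq_one hm k
  refine ⟨(u * m) • z + v • x, L.add_mem (by rw [mul_smul]; exact L.smul_mem u hmz) (L.smul_mem v hx),
    ?_⟩
  rw [smul_add, h, smul_comm ((p : ℤ) ^ k) v, ← mul_smul, ← mul_smul, ← mul_smul, ← add_smul]
  congr 1
  linear_combination (-(↑p ^ k : ℤ)) * huv

end IntModule

section RatModule

variable {V : Type u} [AddCommGroup V] [Module ℚ V]

/-- In a `ℚ`-vector space the integer multiple `m • x` is the rational multiple `(m : ℚ) • x`.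
[folklore] -/
theorem natCast_zsmul_eq_ratCast_smul (m : ℕ) (x : V) : (m : ℤ) • x = (m : ℚ) • x := by
  rw [← Int.cast_smul_eq_zsmul ℚ, Int.cast_natCast]

/-- `m⁻¹ (m x) = x` for `m ≠ 0`. [folklore] -/
theorem inv_smul_natCast_zsmul {m : ℕ} (hm : m ≠ 0) (x : V) :
    (m : ℚ)⁻¹ • ((m : ℤ) • x) = x := by
  rw [natCast_zsmul_eq_ratCast_smul, inv_smul_smul₀ (by exact_mod_cast hm)]

/-- `m (m⁻¹ x) = x` for `m ≠ 0`. [folklore] -/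
theorem natCast_zsmul_inv_smul {m : ℕ} (hm : m ≠ 0) (x : V) :
    (m : ℤ) • ((m : ℚ)⁻¹ • x) = x := by
  rw [natCast_zsmul_eq_ratCast_smul, smul_inv_smul₀ (by exact_mod_cast hm)]

/-- `L_(p)` is a `ℤ_(p)`-module: `m⁻¹ y ∈ L_(p)` for `y ∈ L_(p)` and `m ≥ 1` prime to `p`.
[folklore] -/
theorem inv_smul_mem_localAt {p : ℕ} {L : Submodule ℤ V} {y : V} {m : ℕ} (hm0 : m ≠ 0)
    (hm : m.Coprime p) (hy : y ∈ localAt p L) : (m : ℚ)⁻¹ • y ∈ localAt p L := by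
  obtain ⟨n, hn0, hn, hny⟩ := hy
  refine ⟨n * m, mul_ne_zero hn0 hm0, hn.mul_left hm, ?_⟩
  rwa [Nat.cast_mul, mul_smul, natCast_zsmul_inv_smul hm0]

/-- Localisation commutes with sums. [folklore] -/
theorem localAt_sup (p : ℕ) (L L' : Submodule ℤ V) :
    localAt p (L ⊔ L') = localAt p L ⊔ localAt p L' := by
  refine le_antisymm ?_ (sup_le (localAt_mono p le_sup_left) (localAt_mono p le_sup_right))
  rintro x ⟨m, hm0, hm, hmx⟩
  obtain ⟨y, hy, z, hz, hyz⟩ := Submodule.mem_sup.mp hmx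
  have hx : x = (m : ℚ)⁻¹ • y + (m : ℚ)⁻¹ • z := by
    rw [← smul_add, hyz, inv_smul_natCast_zsmul hm0]
  rw [hx]
  exact Submodule.add_mem_sup (inv_smul_mem_localAt hm0 hm (le_localAt p L hy))
    (inv_smul_mem_localAt hm0 hm (le_localAt p L' hz))

end RatModule


/-! ### The local–global principle for submodules: `L = ⋂ₚ L_(p)` -/

section LocalGlobal

variable {V : Type u} [AddCommGroup V]

/-- If `m x ∈ L` and `n x ∈ L` then `gcd(m, n) x ∈ L` (Bézout). [folklore] -/
theorem gcd_smul_mem {L : Submodule ℤ V} {x : V} {m n : ℕ} (hm : (m : ℤ) • x ∈ L)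
    (hn : (n : ℤ) • x ∈ L) : ((Nat.gcd m n : ℕ) : ℤ) • x ∈ L := by
  rw [Nat.gcd_eq_gcd_ab, add_smul, mul_comm, mul_smul, mul_comm, mul_smul]
  exact L.add_mem (L.smul_mem _ hm) (L.smul_mem _ hn)

/-- **Local–global principle for membership**: an element lying in `L_(p)` for every prime `p`
lies in `L` (the ideal `{m ∈ ℤ | m x ∈ L}` is contained in no prime ideal; Voight Lemma 9.4.6,
here by descent on `m` with Bézout). [cite: Voight2021, Lemma 9.4.6] -/
theorem mem_of_forall_prime_mem_localAt {L : Submodule ℤ V} {x : V}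
    (h : ∀ p : ℕ, p.Prime → x ∈ localAt p L) : x ∈ L := by
  -- some `m₀ ≥ 1` with `m₀ x ∈ L` exists (localise at `2`); descend on `m₀` by strong induction
  have key : ∀ m : ℕ, m ≠ 0 → (m : ℤ) • x ∈ L → x ∈ L := by
    intro m
    induction m using Nat.strong_induction_on with
    | _ m ih =>
      intro hm0 hmx
      by_cases hm1 : m = 1
      · subst hm1
        rwa [Nat.cast_one, one_smul] at hmx
      obtain ⟨p, hp, hpm⟩ := Nat.exists_prime_and_dvd hm1
      obtain ⟨n, hn0, hn, hnx⟩ := h p hp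
      have hg := gcd_smul_mem hmx hnx
      have hg0 : Nat.gcd m n ≠ 0 := Nat.gcd_ne_zero_left hm0
      have hgle : Nat.gcd m n < m := by
        refine lt_of_le_of_ne (Nat.gcd_le_left n (Nat.pos_of_ne_zero hm0)) fun hgm => ?_
        have hpn : p ∣ n := (hgm ▸ hpm).trans (Nat.gcd_dvd_right m n)
        exact hp.one_lt.ne' (Nat.Coprime.eq_one_of_dvd hn.symm hpn)
      exact ih _ hgle hg0 hg
  obtain ⟨m, hm0, -, hmx⟩ := h 2 Nat.prime_two
  exact key m hm0 hmx

/-- `L = ⋂_{p prime} L_(p)` (Voight Lemma 9.4.6). [cite: Voight2021, Lemma 9.4.6] -/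
theorem iInf_localAt_eq (L : Submodule ℤ V) : ⨅ p : {p : ℕ // p.Prime}, localAt p L = L := by
  refine le_antisymm (fun x hx => ?_) (le_iInf fun p => le_localAt p.1 L)
  rw [Submodule.mem_iInf] at hx
  exact mem_of_forall_prime_mem_localAt fun p hp => hx ⟨p, hp⟩

/-- **Inclusion is a local property**: `L ≤ L'` iff `L_(p) ≤ L'_(p)` for all primes `p`
(Voight Cor. 9.4.7). [cite: Voight2021, Cor. 9.4.7] -/
theorem le_iff_forall_prime_localAt_le {L L' : Submodule ℤ V} :
    L ≤ L' ↔ ∀ p : ℕ, p.Prime → localAt p L ≤ localAt p L' :=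
  ⟨fun h p _ => localAt_mono p h, fun h _ hx =>
    mem_of_forall_prime_mem_localAt fun p hp => h p hp (le_localAt p L hx)⟩

/-- **Equality is a local property**: `L = L'` iff `L_(p) = L'_(p)` for all primes `p`
(Voight Cor. 9.4.7). [cite: Voight2021, Cor. 9.4.7] -/
theorem eq_iff_forall_prime_localAt_eq {L L' : Submodule ℤ V} :
    L = L' ↔ ∀ p : ℕ, p.Prime → localAt p L = localAt p L' :=
  ⟨fun h _ _ => h ▸ rfl, fun h => le_antisymm
    (le_iff_forall_prime_localAt_le.mpr fun p hp => (h p hp).le)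
    (le_iff_forall_prime_localAt_le.mpr fun p hp => (h p hp).ge)⟩

end LocalGlobal

/-! ### Indices localise: `[L : L'] = ∏ₚ [L_(p) : L'_(p)]` and `[L_(p) : L'_(p)] = p^{v_p [L : L']}` -/

section Index

variable {V : Type u} [AddCommGroup V]

/-- `[L : L'] • L ⊆ L'` for `L' ≤ L` (the index kills the quotient). [folklore] -/
theorem relIndex_smul_mem {L L' : Submodule ℤ V} {x : V} (hx : x ∈ L) :
    ((L'.toAddSubgroup.relIndex L.toAddSubgroup : ℕ) : ℤ) • x ∈ L' := by
  have h := AddSubgroup.nsmul_index_mem (L'.toAddSubgroup.addSubgroupOf L.toAddSubgroup) ⟨x, hx⟩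
  rw [AddSubgroup.mem_addSubgroupOf] at h
  rw [natCast_zsmul]
  exact h

variable {p : ℕ} [hp : Fact p.Prime]

/-- With `n = [L : L'] ≠ 0` and `p^a ∥ n`: `p^a • L_(p) ⊆ L'_(p)`. [folklore] -/
theorem pow_factorization_smul_mem_localAt {L L' : Submodule ℤ V}
    (hn : L'.toAddSubgroup.relIndex L.toAddSubgroup ≠ 0) {z : V} (hz : z ∈ localAt p L) :
    ((p : ℤ) ^ (L'.toAddSubgroup.relIndex L.toAddSubgroup).factorization p) • z ∈ localAt p L' := by
  set n := L'.toAddSubgroup.relIndex L.toAddSubgroup with hn_def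
  obtain ⟨m, hm0, hm, hmz⟩ := hz
  have hcop : (n / p ^ n.factorization p).Coprime p := (Nat.coprime_ordCompl hp.out hn).symm
  refine ⟨n / p ^ n.factorization p * m, mul_ne_zero ?_ hm0, hcop.mul_left hm, ?_⟩
  · exact (Nat.div_pos (Nat.ordProj_le p hn) (Nat.ordProj_pos n p)).ne'
  · have : ((n / p ^ n.factorization p * m : ℕ) : ℤ) • ((p : ℤ) ^ n.factorization p) • z =
        (n : ℤ) • ((m : ℤ) • z) := by
      rw [← mul_smul, ← mul_smul]
      congr 1
      push_cast
      have h := Nat.ordProj_mul_ordCompl_eq_self n p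
      calc ((n / p ^ n.factorization p : ℕ) : ℤ) * (m : ℤ) * (p : ℤ) ^ n.factorization p
          = ((p ^ n.factorization p * (n / p ^ n.factorization p) : ℕ) : ℤ) * m := by
            push_cast; ring
        _ = (n : ℤ) * m := by rw [h]
    rw [this]
    exact relIndex_smul_mem hmz

/-- `L_(p) = L + L'_(p)` for a finite-index sublattice `L' ≤ L` (`p`-adic approximation). [folklore] -/
theorem localAt_eq_sup_localAt {L L' : Submodule ℤ V} (hle : L' ≤ L)
    (hn : L'.toAddSubgroup.relIndex L.toAddSubgroup ≠ 0) : localAt p L = L ⊔ localAt p L' := by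
  refine le_antisymm (fun x hx => ?_) (sup_le (le_localAt p L) (localAt_mono p hle))
  obtain ⟨y, hy, z, hz, hxy⟩ := exists_sub_mem_of_mem_localAt hx
    ((L'.toAddSubgroup.relIndex L.toAddSubgroup).factorization p)
  have : x = y + (x - y) := by abel
  rw [this, hxy]
  exact Submodule.add_mem_sup hy (pow_factorization_smul_mem_localAt hn hz)

/-- The local index is the index of the `p`-saturation: `[L_(p) : L'_(p)] = [L : L ∩ L'_(p)]`. [folklore] -/
theorem relIndex_localAt_eq_relIndex_inf {L L' : Submodule ℤ V} (hle : L' ≤ L)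
    (hn : L'.toAddSubgroup.relIndex L.toAddSubgroup ≠ 0) :
    (localAt p L').toAddSubgroup.relIndex (localAt p L).toAddSubgroup =
      (L ⊓ localAt p L').toAddSubgroup.relIndex L.toAddSubgroup := by
  have hinf : (L ⊓ localAt p L').toAddSubgroup = (localAt p L').toAddSubgroup ⊓ L.toAddSubgroup :=
    AddSubgroup.ext fun _ => and_comm
  rw [localAt_eq_sup_localAt hle hn, Submodule.sup_toAddSubgroup, sup_comm,
    AddSubgroup.relIndex_sup_left, hinf, AddSubgroup.inf_relIndex_right]

/-- The index of the `p`-saturation `[L : L ∩ L'_(p)]` is a power of `p` (the quotient is killed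
by `p^a`, so Cauchy's theorem allows no other prime). [folklore] -/
theorem exists_relIndex_inf_localAt_eq_pow {L L' : Submodule ℤ V} (hle : L' ≤ L)
    (hn : L'.toAddSubgroup.relIndex L.toAddSubgroup ≠ 0) :
    ∃ k : ℕ, (L ⊓ localAt p L').toAddSubgroup.relIndex L.toAddSubgroup = p ^ k := by
  set M := L ⊓ localAt p L' with hM
  have hMle : L' ≤ M := le_inf hle (le_localAt p L')
  have hM0 : M.toAddSubgroup.relIndex L.toAddSubgroup ≠ 0 := fun h0 =>
    hn (Nat.eq_zero_of_zero_dvd (h0 ▸ AddSubgroup.relIndex_dvd_of_le_left L.toAddSubgroup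
      (show L'.toAddSubgroup ≤ M.toAddSubgroup from hMle)))
  refine ⟨_, Nat.eq_prime_pow_of_unique_prime_dvd hM0 fun {q} hq hqd => ?_⟩
  -- an element of order `q` in `L / M` is killed by `p^a`, so `q = p`
  haveI : Fact q.Prime := ⟨hq⟩
  set a := (L'.toAddSubgroup.relIndex L.toAddSubgroup).factorization p
  haveI : (M.toAddSubgroup.addSubgroupOf L.toAddSubgroup).FiniteIndex := ⟨hM0⟩
  obtain ⟨y, hy⟩ := exists_prime_addOrderOf_dvd_card' (G := L.toAddSubgroup ⧸
    M.toAddSubgroup.addSubgroupOf L.toAddSubgroup) q hqd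
  obtain ⟨x, rfl⟩ := QuotientAddGroup.mk_surjective y
  have hkill : (p ^ a) • (QuotientAddGroup.mk x : L.toAddSubgroup ⧸
      M.toAddSubgroup.addSubgroupOf L.toAddSubgroup) = 0 := by
    rw [← QuotientAddGroup.mk_nsmul, QuotientAddGroup.eq_zero_iff, AddSubgroup.mem_addSubgroupOf]
    refine ⟨L.smul_of_tower_mem _ x.2, ?_⟩
    have := pow_factorization_smul_mem_localAt (p := p) hn (le_localAt p L x.2)
    rwa [← natCast_zsmul, Nat.cast_pow]
  have hdvd : q ∣ p ^ a := by
    rw [← hy]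
    exact addOrderOf_dvd_of_nsmul_eq_zero hkill
  exact (Nat.prime_dvd_prime_iff_eq hq hp.out).mp (hq.dvd_of_dvd_pow hdvd)

/-- The index `[L ∩ L'_(p) : L']` of `L'` in its `p`-saturation is prime to `p` (every element of
the quotient is killed by an integer prime to `p`; Cauchy). [folklore] -/
theorem not_dvd_relIndex_inf_localAt {L L' : Submodule ℤ V} (hle : L' ≤ L)
    (hn : L'.toAddSubgroup.relIndex L.toAddSubgroup ≠ 0) :
    ¬ p ∣ L'.toAddSubgroup.relIndex (L ⊓ localAt p L').toAddSubgroup := by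
  set M := L ⊓ localAt p L' with hM
  have hMle : L' ≤ M := le_inf hle (le_localAt p L')
  have hML : M.toAddSubgroup ≤ L.toAddSubgroup := Submodule.toAddSubgroup_mono inf_le_left
  have hM0 : L'.toAddSubgroup.relIndex M.toAddSubgroup ≠ 0 := fun h0 => by
    have := AddSubgroup.relIndex_mul_relIndex (H := L'.toAddSubgroup) (K := M.toAddSubgroup)
      (L := L.toAddSubgroup) hMle hML
    rw [h0, zero_mul] at this
    exact hn this.symm
  intro hpd
  haveI : (L'.toAddSubgroup.addSubgroupOf M.toAddSubgroup).FiniteIndex := ⟨hM0⟩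
  obtain ⟨y, hy⟩ := exists_prime_addOrderOf_dvd_card' (G := M.toAddSubgroup ⧸
    L'.toAddSubgroup.addSubgroupOf M.toAddSubgroup) p hpd
  obtain ⟨x, rfl⟩ := QuotientAddGroup.mk_surjective y
  obtain ⟨m, hm0, hm, hmx⟩ := (x.2 : (x : V) ∈ M).2
  have hkill : m • (QuotientAddGroup.mk x : M.toAddSubgroup ⧸
      L'.toAddSubgroup.addSubgroupOf M.toAddSubgroup) = 0 := by
    rw [← QuotientAddGroup.mk_nsmul, QuotientAddGroup.eq_zero_iff, AddSubgroup.mem_addSubgroupOf]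
    have : ((m • x : M.toAddSubgroup) : V) = (m : ℤ) • (x : V) := by
      rw [natCast_zsmul]; rfl
    show ((m • x : M.toAddSubgroup) : V) ∈ L'
    rw [this]
    exact hmx
  have hdvd : p ∣ m := by
    rw [← hy]
    exact addOrderOf_dvd_of_nsmul_eq_zero hkill
  exact hp.out.one_lt.ne' (Nat.Coprime.eq_one_of_dvd hm.symm hdvd)

/-- **Indices localise**: for a finite-index sublattice `L' ≤ L` with `[L : L'] = n ≠ 0`,
`[L_(p) : L'_(p)] = p ^ {v_p(n)}` — the local index at `p` is the `p`-part of the index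
(Reiner, *Maximal Orders*, §4; Voight 9.4–9.5). [folklore] -/
theorem relIndex_localAt (L L' : Submodule ℤ V) (hle : L' ≤ L)
    (hn : L'.toAddSubgroup.relIndex L.toAddSubgroup ≠ 0) :
    (localAt p L').toAddSubgroup.relIndex (localAt p L).toAddSubgroup =
      p ^ (L'.toAddSubgroup.relIndex L.toAddSubgroup).factorization p := by
  set M := L ⊓ localAt p L' with hM
  have hMle : L' ≤ M := le_inf hle (le_localAt p L')
  have hML : M.toAddSubgroup ≤ L.toAddSubgroup := Submodule.toAddSubgroup_mono inf_le_left
  have hmul := AddSubgroup.relIndex_mul_relIndex (H := L'.toAddSubgroup) (K := M.toAddSubgroup)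
      (L := L.toAddSubgroup) hMle hML
  obtain ⟨k, hk⟩ := exists_relIndex_inf_localAt_eq_pow (p := p) hle hn
  have hcop := not_dvd_relIndex_inf_localAt (p := p) hle hn
  rw [relIndex_localAt_eq_relIndex_inf hle hn, hk]
  congr 1
  have hc0 : L'.toAddSubgroup.relIndex M.toAddSubgroup ≠ 0 := fun h0 => by
    rw [h0, zero_mul] at hmul; exact hn hmul.symm
  rw [← hmul, hk, Nat.factorization_mul hc0 (pow_ne_zero k hp.out.ne_zero), Finsupp.add_apply,
    hp.out.factorization_pow, Nat.factorization_eq_zero_of_not_dvd hcop]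
  simp


/-- **`[L : L'] = ∏ₚ [L_(p) : L'_(p)]`**, the product over the primes dividing the (finite,
non-zero) index. [folklore] -/
theorem prod_relIndex_localAt (L L' : Submodule ℤ V) (hle : L' ≤ L)
    (hn : L'.toAddSubgroup.relIndex L.toAddSubgroup ≠ 0) :
    ∏ q ∈ (L'.toAddSubgroup.relIndex L.toAddSubgroup).primeFactors,
        (localAt q L').toAddSubgroup.relIndex (localAt q L).toAddSubgroup =
      L'.toAddSubgroup.relIndex L.toAddSubgroup := by
  conv_rhs => rw [← Nat.prod_factorization_pow_eq_self hn]
  rw [Nat.prod_factorization_eq_prod_primeFactors]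
  refine Finset.prod_congr rfl fun q hq => ?_
  haveI : Fact q.Prime := ⟨Nat.prime_of_mem_primeFactors hq⟩
  exact relIndex_localAt L L' hle hn

end Index

/-! ### Gluing local data: the local–global construction of lattices -/

section Glue

variable {V : Type u} [AddCommGroup V]

/-- If `p ^ r x ∈ L` then `x ∈ L_(q)` for every prime `q ≠ p` (`p ^ r` is prime to `q`). [folklore] -/
theorem mem_localAt_of_pow_smul_mem {p q : ℕ} (hp : p.Prime) (hq : q.Prime) (hpq : p ≠ q)
    {L : Submodule ℤ V} {x : V} (r : ℕ) (hx : ((p : ℤ) ^ r) • x ∈ L) : x ∈ localAt q L :=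
  ⟨p ^ r, pow_ne_zero r hp.ne_zero, ((Nat.coprime_primes hp hq).mpr hpq).pow_left r,
    by rwa [Nat.cast_pow]⟩

/-- **Local–global construction (gluing)**: given a `ℤ`-submodule `L`, a prime `p` and a
`ℤ_(p)`-module `N ⊆ V` commensurable with `L_(p)` (`p^r L ⊆ N` and `p^r N ⊆ L_(p)`), there is a
submodule `M` — namely `N ∩ ⋂_{q ≠ p} L_(q)` — with `M_(p) = N` and `M_(q) = L_(q)` for all primes
`q ≠ p`; moreover `p^r L ⊆ M` and `p^r M ⊆ L` (so `M` is a full lattice when `L` is). By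
`eq_iff_forall_prime_localAt_eq` such an `M` is unique (Voight, *Quaternion Algebras*,
Thm. 9.4.9, for one prime at a time, over `R = ℤ`). [cite: Voight2021, Thm. 9.4.9] -/
theorem exists_localAt_eq_and_forall_localAt_eq {p : ℕ} (hp : p.Prime) (L N : Submodule ℤ V)
    (hN : localAt p N = N) (r : ℕ) (hLN : ∀ x ∈ L, ((p : ℤ) ^ r) • x ∈ N)
    (hNL : ∀ x ∈ N, ((p : ℤ) ^ r) • x ∈ localAt p L) :
    ∃ M : Submodule ℤ V, localAt p M = N ∧ (∀ q : ℕ, q.Prime → q ≠ p → localAt q M = localAt q L) ∧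
      (∀ x ∈ L, ((p : ℤ) ^ r) • x ∈ M) ∧ (∀ x ∈ M, ((p : ℤ) ^ r) • x ∈ L) := by
  let M : Submodule ℤ V := N ⊓ ⨅ q : {q : ℕ // q.Prime ∧ q ≠ p}, localAt q L
  have hMq : ∀ x, x ∈ M ↔ x ∈ N ∧ ∀ q : ℕ, q.Prime → q ≠ p → x ∈ localAt q L := fun x => by
    simp only [M, Submodule.mem_inf, Submodule.mem_iInf, Subtype.forall, and_imp]
  have hprL : ∀ x ∈ L, ((p : ℤ) ^ r) • x ∈ M := fun x hx =>
    (hMq _).mpr ⟨hLN x hx, fun q _ _ => (localAt q L).smul_mem _ (le_localAt q L hx)⟩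
  refine ⟨M, ?_, fun q hq hqp => ?_, hprL, fun x hx => ?_⟩
  · -- `M_(p) = N`
    refine le_antisymm (hN ▸ localAt_mono p inf_le_left) fun x hx => ?_
    obtain ⟨m, hm0, hm, hmx⟩ := hNL x hx
    refine ⟨m, hm0, hm, (hMq _).mpr ⟨N.smul_mem _ hx, fun q hq hqp => ?_⟩⟩
    refine mem_localAt_of_pow_smul_mem hp hq (Ne.symm hqp) r ?_
    rwa [smul_comm]
  · -- `M_(q) = L_(q)` for `q ≠ p`
    refine le_antisymm (localAt_le_localAt_iff.mpr fun x hx => ((hMq x).mp hx).2 q hq hqp)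
      (localAt_le_localAt_iff.mpr fun x hx => ?_)
    exact ⟨p ^ r, pow_ne_zero r hp.ne_zero,
      ((Nat.coprime_primes hp hq).mpr (Ne.symm hqp)).pow_left r, by
        rw [Nat.cast_pow]; exact hprL x hx⟩
  · -- `p^r M ⊆ L`
    refine mem_of_forall_prime_mem_localAt fun q hq => ?_
    by_cases hqp : q = p
    · subst hqp
      exact hNL x ((hMq x).mp hx).1
    · exact (localAt q L).smul_mem _ (((hMq x).mp hx).2 q hq hqp)

/-- Two commensurable submodules (`m L' ⊆ L` and `m' L ⊆ L'` with `m, m' ≥ 1`) have the same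
localisation at every prime not dividing `m m'` — in particular full lattices agree locally at
almost all primes. [folklore] -/
theorem localAt_eq_of_smul_le_of_smul_le {L L' : Submodule ℤ V} {m m' : ℕ} (hm0 : m ≠ 0)
    (hm'0 : m' ≠ 0) (hm : ∀ x ∈ L', (m : ℤ) • x ∈ L) (hm' : ∀ x ∈ L, (m' : ℤ) • x ∈ L') {p : ℕ}
    (hpm : m.Coprime p) (hpm' : m'.Coprime p) : localAt p L = localAt p L' :=
  localAt_eq_of_le_of_le (fun x hx => ⟨m', hm'0, hpm', hm' x hx⟩) fun x hx => ⟨m, hm0, hpm, hm x hx⟩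

end Glue

/-! ### Localisation in a `ℚ`-algebra: products and translates -/

section Algebra

variable {B : Type u} [Ring B]

/-- `L_(p) L'_(p) ⊆ (L L')_(p)`. [folklore] -/
theorem localAt_mul_localAt_le (p : ℕ) (L L' : Submodule ℤ B) :
    localAt p L * localAt p L' ≤ localAt p (L * L') := by
  rw [Submodule.mul_le]
  rintro x ⟨m, hm0, hm, hmx⟩ y ⟨n, hn0, hn, hny⟩
  refine ⟨m * n, mul_ne_zero hm0 hn0, hm.mul_left hn, ?_⟩
  have : ((m * n : ℕ) : ℤ) • (x * y) = ((m : ℤ) • x) * ((n : ℤ) • y) := by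
    rw [Nat.cast_mul, mul_smul, smul_mul_assoc, mul_smul_comm, smul_comm]
  rw [this]
  exact Submodule.mul_mem_mul hmx hny

/-- **Localisation commutes with products**: `(L L')_(p) = (L_(p) L'_(p))_(p)`. [folklore] -/
theorem localAt_mul (p : ℕ) (L L' : Submodule ℤ B) :
    localAt p (localAt p L * localAt p L') = localAt p (L * L') :=
  le_antisymm (by simpa using localAt_mono p (localAt_mul_localAt_le p L L'))
    (localAt_mono p (Submodule.mul_le.mpr fun _ hx _ hy =>
      Submodule.mul_mem_mul (le_localAt p L hx) (le_localAt p L' hy)))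

/-- Localisation commutes with left translation by a unit: `(b L)_(p) = b L_(p)`. [folklore] -/
theorem localAt_units_smul (p : ℕ) (b : Bˣ) (L : Submodule ℤ B) :
    localAt p (b • L) = b • localAt p L := by
  ext x
  rw [mem_units_smul_submodule_iff, mem_localAt_iff, mem_localAt_iff]
  refine exists_congr fun m => ?_
  rw [mem_units_smul_submodule_iff, Units.smul_def, Units.smul_def, smul_eq_mul, smul_eq_mul,
    mul_smul_comm]

/-- Localisation commutes with right translation by a unit: `(L b)_(p) = L_(p) b`. [folklore] -/
theorem localAt_op_units_smul (p : ℕ) (b : Bˣ) (L : Submodule ℤ B) :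
    localAt p (MulOpposite.op (b : B) • L) = MulOpposite.op (b : B) • localAt p L := by
  ext x
  rw [mem_localAt_iff, Submodule.mem_smul_pointwise_iff_exists]
  constructor
  · rintro ⟨m, hm0, hm, hmx⟩
    obtain ⟨y, hy, hyx⟩ := (Submodule.mem_smul_pointwise_iff_exists _ _ _).mp hmx
    refine ⟨x * ((b⁻¹ : Bˣ) : B), ⟨m, hm0, hm, ?_⟩, ?_⟩
    · rw [← smul_mul_assoc, ← hyx, MulOpposite.smul_eq_mul_unop, MulOpposite.unop_op,
        Units.mul_inv_cancel_right]
      exact hy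
    · rw [MulOpposite.smul_eq_mul_unop, MulOpposite.unop_op, Units.inv_mul_cancel_right]
  · rintro ⟨y, ⟨m, hm0, hm, hmy⟩, rfl⟩
    refine ⟨m, hm0, hm, ?_⟩
    rw [MulOpposite.smul_eq_mul_unop, MulOpposite.unop_op, ← smul_mul_assoc]
    exact (Submodule.mem_smul_pointwise_iff_exists _ _ _).mpr ⟨_, hmy, by
      rw [MulOpposite.smul_eq_mul_unop, MulOpposite.unop_op]⟩

variable [Algebra ℚ B]

/-- `(L L')_(p) ⊆ L · L'_(p)`: dividing `m x = ∑ aᵢ bᵢ` by `m` inside the second factor. [folklore] -/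
theorem localAt_mul_le_mul_localAt (p : ℕ) (L L' : Submodule ℤ B) :
    localAt p (L * L') ≤ L * localAt p L' := by
  rintro x ⟨m, hm0, hm, hmx⟩
  have hx : x = (m : ℚ)⁻¹ • ((m : ℤ) • x) := (inv_smul_natCast_zsmul hm0 x).symm
  rw [hx]
  refine Submodule.mul_induction_on hmx (fun a ha b hb => ?_) (fun y z hy hz => ?_)
  · rw [← mul_smul_comm]
    exact Submodule.mul_mem_mul ha (inv_smul_mem_localAt hm0 hm (le_localAt p L' hb))
  · rw [smul_add]
    exact add_mem hy hz

/-- **`(L L')_(p) = L_(p) L'_(p) = L L'_(p)`** in a `ℚ`-algebra: the product of localised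
lattices is already `ℤ_(p)`-saturated. [folklore] -/
theorem localAt_mul_localAt_eq (p : ℕ) (L L' : Submodule ℤ B) :
    localAt p L * localAt p L' = localAt p (L * L') :=
  le_antisymm (localAt_mul_localAt_le p L L') ((localAt_mul_le_mul_localAt p L L').trans
    (Submodule.mul_le.mpr fun _ ha _ hb => Submodule.mul_mem_mul (le_localAt p L ha) hb))

/-- `L · L'_(p) = (L L')_(p)`. [folklore] -/
theorem mul_localAt_eq (p : ℕ) (L L' : Submodule ℤ B) : L * localAt p L' = localAt p (L * L') :=
  le_antisymm ((Submodule.mul_le.mpr fun _ ha _ hb =>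
    Submodule.mul_mem_mul (le_localAt p L ha) hb).trans (localAt_mul_localAt_le p L L'))
    (localAt_mul_le_mul_localAt p L L')

/-- Powers localise: `(L_(p))^k = (L^k)_(p)` for `k ≥ 1`. [folklore] -/
theorem localAt_pow_succ (p : ℕ) (L : Submodule ℤ B) (k : ℕ) :
    localAt p L ^ (k + 1) = localAt p (L ^ (k + 1)) := by
  induction k with
  | zero => rw [pow_one, pow_one]
  | succ k ih => rw [pow_succ, ih, localAt_mul_localAt_eq, ← pow_succ]

end Algebra

end Literature.NumberTheory.Automorphic
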